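import Mathlib

/-!
# SoloBlindRigidity — the Hermitian rigidity lemma of THEOREM M♮: a product of reflections in
# pairwise orthogonal roots negates each of them, so it lies in no group stabilising a positive
# system of noncompact roots

Solo seat `solo-Langlands-blind`, session 52 (kernel core of the RIGIDITY LEMMA used twice in the
prose proof of THEOREM M♮, research notes s50 Steps 6 and 8; companion of
`SoloBlindNoncompactRoots`, which supplies the pairwise orthogonality of the roots vanishing on a
non-degenerate singular Harish-Chandra parameter).

Dictionary.  `P` = the root system `Δ(𝔤_ℂ, 𝔱'_ℂ)` of a connected linear equal-rank real group `G`
with `G/K` Hermitian symmetric; `Pos ⊆ M` = the set `Δ(𝔭⁺)` of noncompact roots of the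
holomorphic tangent space (hypothesis `hPos`: `Δ(𝔭⁺) ∩ Δ(𝔭⁻) = ∅`, i.e. no root lies in `Pos`
together with its negative — true because `Δ(𝔭⁺)` is contained in a positive system);
`W` = the compact Weyl group `W_K = N_K(T')/T'` acting on `𝔱'^*`: since `K` is connected and
`Ad K` preserves `𝔭⁺`, every element of `W_K` maps `Δ(𝔭⁺)` into itself (hypothesis `hW`);
`L` = a nonempty list of indices of pairwise (strongly) orthogonal roots `β_j ∈ Δ(𝔭⁺)` (the set
`B`, or a nonempty subset `S ⊆ B`, of the cuspidal datum in THEOREM M♮), and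
`(L.map P.reflection).prod = s_S = ∏_{j ∈ S} s_{β_j}`.
Conclusions: `prod_reflection_apply_root_eq_neg` — `s_S β_k = -β_k` for every `k ∈ S`
(each `s_{β_j}`, `j ≠ k`, fixes `β_k` by orthogonality and `s_{β_k} β_k = -β_k`);
`prod_reflection_not_mem` / `prod_reflection_not_mem_stabilizer` — RIGIDITY: `s_S ∉ W_K` for
`S ≠ ∅`, because `s_S β_k = -β_k ∉ Δ(𝔭⁺)` while `W_K` preserves `Δ(𝔭⁺)`;
`prod_reflection_perm` — `s_S` does not depend on the order of the factors (the reflections in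
orthogonal roots commute, Mathlib's `RootPairing.isOrthogonal_comm`).
Uses in THEOREM M♮ (prose, research notes s50): (i) Step 6 — the `2^r` non-degenerate limits of
discrete series `Θ^G(λ', C')`, `C' ∋ λ'`, are pairwise inequivalent, since by Knapp–Zuckerman an
equivalence `Θ(λ', C') ≅ Θ(λ', s_S C')` would be implemented by some `w ∈ W_K` fixing `λ'`, forcing
`w = s_S ∈ W_K`; (ii) Step 8, LEMMA T — an element of `Z_K(𝔟₀ ⊕ 𝔞₀)` acting by signs `ε_j` on the
Cayley lines represents `s_S ∈ W_K` with `S = {j : ε_j = -1}`, hence `S = ∅`.  Off the Hermitian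
class the hypothesis `hW` fails and so does the conclusion (split `SO₀(3,4)`,
`B = {e₁ - e₂, e₁ + e₂, e₃}`: `s_B = -1 ∈ W_K`).  The statements below are pure root-system algebra
over an arbitrary commutative ring; no Lie theory is formalised here.

[cite: KnappZuckerman1982, §1, Theorem 1.1(c)] [cite: KnappVogan1995, (11.184), Proposition 11.192]
-/

namespace Summit.Langlands.Langlands.Theorems.SoloBlind

open Set Function

variable {ι R M N : Type*} [CommRing R] [AddCommGroup M] [Module R M]
  [AddCommGroup N] [Module R N] (P : RootPairing ι R M N)

/-- A product of reflections in roots all orthogonal to `β_k` fixes `β_k`. -/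
theorem prod_reflection_apply_root_of_forall_isOrthogonal (L : List ι) (k : ι)
    (h : ∀ j ∈ L, P.IsOrthogonal j k) :
    (L.map P.reflection).prod (P.root k) = P.root k := by
  induction L with
  | nil => simp
  | cons a L ih =>
    rw [List.map_cons, List.prod_cons, LinearEquiv.mul_apply,
      ih (fun j hj => h j (List.mem_cons_of_mem a hj)),
      (h a (by simp)).symm.reflection_apply_left]

/-- **`s_S β_k = -β_k`.**  For a duplicate-free list `L` of indices of pairwise orthogonal roots
and `k ∈ L`, the product `s_L = ∏_{j ∈ L} s_{β_j}` sends `β_k` to `-β_k`. -/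
theorem prod_reflection_apply_root_eq_neg (L : List ι) (hL : L.Nodup)
    (horth : ∀ i ∈ L, ∀ j ∈ L, i ≠ j → P.IsOrthogonal i j) (k : ι) (hk : k ∈ L) :
    (L.map P.reflection).prod (P.root k) = -P.root k := by
  induction L with
  | nil => simp at hk
  | cons a L ih =>
    rw [List.nodup_cons] at hL
    rw [List.map_cons, List.prod_cons, LinearEquiv.mul_apply]
    rcases List.mem_cons.mp hk with h | hk'
    · -- `k = a ∉ L`: the tail fixes `β_k`, then `s_{β_k}` negates it
      rw [prod_reflection_apply_root_of_forall_isOrthogonal P L k ?_, h,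
        RootPairing.reflection_apply_self]
      intro j hj
      have hjk : j ≠ k := by
        rintro rfl
        exact hL.1 (h ▸ hj)
      exact horth j (List.mem_cons_of_mem a hj) k (h ▸ List.mem_cons_self) hjk
    · -- `k` in the tail: by induction the tail negates `β_k`, and `s_{β_a}` fixes it (`a ≠ k`)
      have hak : a ≠ k := by
        rintro rfl
        exact hL.1 hk'
      rw [ih hL.2 (fun i hi j hj hij => horth i (List.mem_cons_of_mem a hi) j
        (List.mem_cons_of_mem a hj) hij) hk', map_neg,
        (horth a List.mem_cons_self k (List.mem_cons_of_mem a hk') hak).symm.reflection_apply_left]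

/-- **RIGIDITY (abstract form).**  Let `Pos ⊆ M` contain no element together with its negative,
and let `W` be a subgroup of `GL(M)` mapping `Pos` into itself.  If `L` is a nonempty
duplicate-free list of indices of pairwise orthogonal roots lying in `Pos`, then
`s_L = ∏_{j ∈ L} s_{β_j} ∉ W`. -/
theorem prod_reflection_not_mem (Pos : Set M) (hPos : ∀ x ∈ Pos, -x ∉ Pos)
    (W : Subgroup (M ≃ₗ[R] M)) (hW : ∀ w ∈ W, MapsTo w Pos Pos)
    (L : List ι) (hL : L.Nodup) (horth : ∀ i ∈ L, ∀ j ∈ L, i ≠ j → P.IsOrthogonal i j)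
    (hne : L ≠ []) (hpos : ∀ k ∈ L, P.root k ∈ Pos) :
    (L.map P.reflection).prod ∉ W := by
  intro hmem
  obtain ⟨k, hk⟩ := List.exists_mem_of_ne_nil L hne
  have h1 := hW _ hmem (hpos k hk)
  rw [prod_reflection_apply_root_eq_neg P L hL horth k hk] at h1
  exact hPos _ (hpos k hk) h1

open Pointwise in
/-- **RIGIDITY, stabiliser form.**  With `Pos` as above, `s_L` does not lie in the set-wise
stabiliser of `Pos` in `GL(M)` — in the dictionary: `s_S ∉ W_K` for `∅ ≠ S ⊆ B`, since `W_K`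
stabilises `Δ(𝔭⁺)`. -/
theorem prod_reflection_not_mem_stabilizer (Pos : Set M) (hPos : ∀ x ∈ Pos, -x ∉ Pos)
    (L : List ι) (hL : L.Nodup) (horth : ∀ i ∈ L, ∀ j ∈ L, i ≠ j → P.IsOrthogonal i j)
    (hne : L ≠ []) (hpos : ∀ k ∈ L, P.root k ∈ Pos) :
    (L.map P.reflection).prod ∉ MulAction.stabilizer (M ≃ₗ[R] M) Pos := by
  refine prod_reflection_not_mem P Pos hPos _ (fun w hw x hx => ?_) L hL horth hne hpos
  rw [MulAction.mem_stabilizer_iff] at hw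
  have hx' : w • x ∈ w • Pos := Set.smul_mem_smul_set hx
  rw [hw, LinearEquiv.smul_def] at hx'
  exact hx'

open Pointwise in
/-- Any subgroup contained in the stabiliser of `Pos` (e.g. `W_K ≤ Stab(Δ(𝔭⁺))`) misses `s_L`
as well. -/
theorem prod_reflection_not_mem_of_le_stabilizer (Pos : Set M) (hPos : ∀ x ∈ Pos, -x ∉ Pos)
    (W : Subgroup (M ≃ₗ[R] M))
    (hW : W ≤ MulAction.stabilizer (M ≃ₗ[R] M) Pos)
    (L : List ι) (hL : L.Nodup) (horth : ∀ i ∈ L, ∀ j ∈ L, i ≠ j → P.IsOrthogonal i j)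
    (hne : L ≠ []) (hpos : ∀ k ∈ L, P.root k ∈ Pos) :
    (L.map P.reflection).prod ∉ W :=
  fun h => prod_reflection_not_mem_stabilizer P Pos hPos L hL horth hne hpos (hW h)

/-- The element `s_L` does not depend on the order of the factors: reflections in pairwise
orthogonal roots commute. -/
theorem prod_reflection_perm {L L' : List ι} (hp : L.Perm L') (hL : L.Nodup)
    (horth : ∀ i ∈ L, ∀ j ∈ L, i ≠ j → P.IsOrthogonal i j) :
    (L.map P.reflection).prod = (L'.map P.reflection).prod := by
  apply (hp.map P.reflection).prod_eq'
  rw [List.pairwise_map]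
  exact hL.pairwise_of_forall_ne (fun i hi j hj hij => P.isOrthogonal_comm i j (horth i hi j hj hij))

/-- `s_L` is an involution. -/
theorem prod_reflection_mul_self (L : List ι) (hL : L.Nodup)
    (horth : ∀ i ∈ L, ∀ j ∈ L, i ≠ j → P.IsOrthogonal i j) :
    (L.map P.reflection).prod * (L.map P.reflection).prod = 1 := by
  induction L with
  | nil => simp
  | cons a L ih =>
    rw [List.nodup_cons] at hL
    have horth' : ∀ i ∈ L, ∀ j ∈ L, i ≠ j → P.IsOrthogonal i j :=
      fun i hi j hj hij => horth i (List.mem_cons_of_mem a hi) j (List.mem_cons_of_mem a hj) hij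
    -- `s_a` commutes with the tail product
    have hc : Commute (P.reflection a) ((L.map P.reflection).prod) := by
      apply Commute.list_prod_right
      intro s hs
      obtain ⟨j, hj, rfl⟩ := List.mem_map.mp hs
      have haj : a ≠ j := by
        rintro rfl
        exact hL.1 hj
      exact P.isOrthogonal_comm a j (horth a List.mem_cons_self j (List.mem_cons_of_mem a hj) haj)
    rw [List.map_cons, List.prod_cons]
    calc P.reflection a * (L.map P.reflection).prod * (P.reflection a * (L.map P.reflection).prod)
        = P.reflection a * ((L.map P.reflection).prod * P.reflection a)
            * (L.map P.reflection).prod := by group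
      _ = P.reflection a * (P.reflection a * (L.map P.reflection).prod)
            * (L.map P.reflection).prod := by rw [hc.eq]
      _ = (P.reflection a * P.reflection a) * ((L.map P.reflection).prod
            * (L.map P.reflection).prod) := by group
      _ = 1 := by rw [ih hL.2 horth']; ext x; simp

end Summit.Langlands.Langlands.Theorems.SoloBlind
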